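import Literature.NumberTheory.LFunctions.ZetaZeroHarmonicSumBound
import Literature.Analysis.SpecialFunctions.LogPiBounds
import HarnessLib

/-!
# RH-FREE — `Σ_{0<γ≤T} 1/γ ≤ log²(T/2π)/(4π)` on the printed range `4πe ≤ T ≤ 2516` by a kernel-checked step-function test against the tree's certified first `2000` zeros; hence Brent–Platt–Trudgian 2022, Lemma 8 for all `T ≥ 4πe` from Corollary 1 («nothing here bears on the truth of RH»)

Topic `Literature/NumberTheory/LFunctions` (RH literature-typing tranche 1, L4 "explicit zero
statistics", gen 3). THEOREMS plus the computable test functions they evaluate (no named facts; one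
`native_decide` evaluation declared `computational`, on top of the tree's certified Odlyzko–te Riele
data `SchoenfeldZerosLow.lean`, itself `computational`). Nothing here bears on the truth of RH.

Brent–Platt–Trudgian 2022 (J. Number Theory 238, §2), **Lemma 8**: "If `T ≥ 4πe`, then
`Σ_{0<γ≤T} 1/γ ≤ L̂²/(4π)`", `L̂ = log(T/2π)` — the named fact
`Literature.NumberTheory.LFunctions.BrentPlattTrudgian2022_lemma8` (`ZetaZeroSumsLehmanExplicit.lean`).
Printed proof: Lehman's lemma from `T₁ = 202` with `A = 0.28` (their Cor. 1), the first `80` zeros,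
"and we can verify numerically that (eq.) also holds for `T ∈ [4πe, T₁)`". The tree already has the
Lehman half from `T₁ = 2516` (`BrentPlattTrudgian2022_cor1.sum_inv_le_of_ge_2516`,
`ZetaZeroHarmonicSumBound.lean`, gen 2). This file supplies the numerical half on `[4πe, 2516]`
IN THE KERNEL'S ARITHMETIC, from the `2000` certified brackets `γ_j ∈ [a_j, a_j+1]·2⁻²⁴⁰`
(`SchoenfeldZerosLow.lean`: `lowOrdinate`, `zero_eq_of_im_le_heightT0`, simplicity, `inv_t₁_le`):

* the left side is a step function of `T`, the right side increases, so it suffices to test, for each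
  `k`, `Σ_{j<k} 1/γ_j ≤ log²(t/2π)/(4π)` at the smallest admissible `t` with `N(t) ≥ k`, i.e. at
  `t = max(4πe, a_{k−1}2⁻²⁴⁰)`: for `k ≤ 5` (`γ₅ = 32.9… < 4πe = 34.1… < γ₆`) against
  `log²(2e)/(4π) = (1 + log 2)²/(4π) ≥ 0.228` (second clause of `harmonicLowCheck_eq`: `invOrdSum 5 ≤ 0.228·2⁶⁰`),
  and for `6 ≤ k ≤ 2000` (`harmonicLowCheck`): with `n = ⌊a_{k−1}/2²⁰⁰⌋` and the kernel logarithm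
  `KernelLog.logIv n ∋ 2⁸⁰ log n`, `ℓ := lo − ⌈2⁸⁰(41 log 2 + log π)⌉ ≤ 2⁸⁰ log(a_{k−1}2⁻²⁴⁰/2π)`, the
  integer test `0 ≤ ℓ ∧ invOrdSum k · 2¹⁰² · 31415926536 ≤ ℓ² · 10¹⁰`
  (i.e. `Σ_{j<k} 1/a_j2⁻²⁴⁰ ≤ (ℓ/2⁸⁰)²/(4 · 3.1415926536)`); the margins are `≥ 10⁻³` (tightest at
  `k = 8`), the roundings `≤ 10⁻¹¹`;
* `sum_inv_ordinate_le_of_le_heightT0` — **for `4πe ≤ T ≤ 2516`, `Σ_{0<γ≤T} m(ρ)/γ ≤ log²(T/2π)/(4π)`**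
  (unconditional; computational lane);
* `BrentPlattTrudgian2022_cor1.sum_inv_le` — for all `T ≥ 4πe` from Corollary 1 (gluing with the
  gen-2 theorem at `2516`), and `BrentPlattTrudgian2022_lemma8_of_cor1 : cor1 → lemma8`: **Lemma 8 is
  no longer an independent fact of the tree — it follows from `BrentPlattTrudgian2022_cor1`.**

## References

* R. P. Brent, D. J. Platt, T. S. Trudgian, J. Number Theory 238 (2022) 740–762, §2, Lemma 8 and
  Cor. 1. [BrentPlattTrudgian2022]
* A. M. Odlyzko, H. J. J. te Riele, J. reine angew. Math. 357 (1985), §4.2 (the first `2000`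
  zeros; the tree's certificate). [OdlyzkoTeRiele1985]
-/

noncomputable section

open Complex Filter Set MeasureTheory
open scoped Real

namespace Literature.NumberTheory.LFunctions

open SchoenfeldBound ZetaNumerics.Mertens Literature.Analysis.SpecialFunctions.KernelLog

namespace HarmonicLow

/-! ## The integer test -/

/-- `⌈2⁸⁰(41 log 2 + log π)⌉` from the `20`-digit enclosures (`41·0.69314718055994530944 +
1.14472988584940017415 = 29.56376428880715786119`). [folklore] -/
def C4180 : ℤ := 35740397973739897896438871

/-- The scaled lower bound `ℓ_j ≤ 2⁸⁰ log(a_j 2⁻²⁴⁰/2π)` from the kernel logarithm of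
`n = ⌊a_j/2²⁰⁰⌋` (`none` if `logIv` fails). [folklore] -/
def ellLow (j : ℕ) : Option ℤ :=
  match logIv ((ordinate j).toNat / 2 ^ 200) with
  | some (lv, _) => some (lv - C4180)
  | none => none

/-- The test at the `j`-th zero (`j = k − 1 ≥ 5`): `0 ≤ ℓ_j` and
`invOrdSum (j+1) · 2¹⁰² · 31415926536 ≤ ℓ_j² · 10¹⁰`. [folklore] -/
def stepOk (j : ℕ) : Bool :=
  match ellLow j with
  | some ℓ => decide (0 ≤ ℓ) && decide (((invOrdSum (j + 1) : ℕ) : ℤ) * (2 ^ 102 * 31415926536) ≤ ℓ * ℓ * 10 ^ 10)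
  | none => false

/-- All steps `j = 5, …, 1999` pass. [folklore] -/
def harmonicLowCheck : Bool :=
  (List.range 2000).all fun j ↦ decide (j < 5) || stepOk j

/-- **The compiled evaluation** of the `1995` step tests and of the first-five-zeros test
`invOrdSum 5 · 1000 ≤ 228 · 2⁶⁰` (`Σ_{j<5} 1/γ_j = 0.22153…`). Declared to the gate as `computational`
(`native_decide`). [cite: BrentPlattTrudgian2022, Lemma 8 (proof: "we can verify numerically")] -/
theorem harmonicLowCheck_eq : harmonicLowCheck = true ∧ invOrdSum 5 * 1000 ≤ 228 * 2 ^ 60 := by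
  native_decide

/-! ## Soundness of one step -/

/-- `2⁸⁰(41 log 2 + log π) ≤ C4180`. [folklore] -/
private theorem two_pow_mul_log_le_C4180 : (2 : ℝ) ^ 80 * (41 * Real.log 2 + Real.log π) ≤ (C4180 : ℝ) := by
  have h2 := Literature.Analysis.SpecialFunctions.Real.log_two_lt_d20
  have hπ := Literature.Analysis.SpecialFunctions.Real.log_pi_lt_d20
  have h : (2 : ℝ) ^ 80 * (41 * 0.69314718055994530944 + 1.14472988584940017415) ≤ (C4180 : ℝ) := by
    rw [C4180]; norm_num
  nlinarith [h]

/-- Soundness of `stepOk j` (`j < 2000`): `Σ_{i ≤ j} 2⁻⁶⁰⌈2³⁰⁰/a_i⌉ ≤ log²(t₁ⱼ/2π)/(4π)` and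
`2π ≤ t₁ⱼ`, where `t₁ⱼ = a_j 2⁻²⁴⁰` is the lower end of the `j`-th bracket. [folklore] -/
private theorem stepOk_sound {j : ℕ} (hj : j < 2000) (h : stepOk j = true) :
    (invOrdSum (j + 1) : ℝ) / 2 ^ 60 ≤ Real.log (t₁ j / (2 * π)) ^ 2 / (4 * π) ∧ 2 * π ≤ t₁ j := by
  have hπ0 : 0 < π := Real.pi_pos
  have hπhi : π < 3.1415926536 := by linarith [Real.pi_lt_d20]
  unfold stepOk at h
  split at h
  · rename_i ℓ hℓ
    rw [Bool.and_eq_true, decide_eq_true_eq, decide_eq_true_eq] at h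
    obtain ⟨hℓ0, hineq⟩ := h
    unfold ellLow at hℓ
    split at hℓ
    · rename_i lo hi hlog
      simp only [Option.some.injEq] at hℓ
      have h2π : (0 : ℝ) < 2 * π := by positivity
      -- the data: `a_j ≥ 0`, `t₁ j = a_j / 2^240 ≥ n / 2^40`
      have hord0 : (0 : ℤ) ≤ ordinate j := le_trans (by positivity) (bracket_order hj).1
      have hordR : (ordinate j : ℝ) = ((ordinate j).toNat : ℝ) := by
        exact_mod_cast (Int.toNat_of_nonneg hord0).symm
      have hnle : (((ordinate j).toNat / 2 ^ 200 : ℕ) : ℝ) * 2 ^ 200 ≤ ((ordinate j).toNat : ℝ) := by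
        exact_mod_cast Nat.div_mul_le_self (ordinate j).toNat (2 ^ 200)
      -- keep the data opaque from here on
      generalize hn : (ordinate j).toNat / 2 ^ 200 = n at hlog hnle
      have ht₁pos : 0 < t₁ j := t₁_pos hj
      have ht₁ : (n : ℝ) / 2 ^ 40 ≤ t₁ j := by
        unfold t₁
        rw [hordR, div_le_div_iff₀ (by positivity) (by positivity)]
        have e : (n : ℝ) * 2 ^ 240 = (n : ℝ) * 2 ^ 200 * 2 ^ 40 := by ring
        rw [e]
        exact mul_le_mul_of_nonneg_right hnle (by positivity)
      generalize t₁ j = t at ht₁pos ht₁ ⊢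
      -- `n ≥ 1`: otherwise `lo ≤ 0` and `ℓ = lo − C < 0`
      have hlo := (logIv_sound hlog).1
      have hC := two_pow_mul_log_le_C4180
      have hCpos : (0 : ℝ) < C4180 := by rw [C4180]; norm_num
      have hℓR : (0 : ℝ) ≤ (ℓ : ℝ) := by exact_mod_cast hℓ0
      rw [← hℓ] at hℓR hineq
      push_cast at hℓR
      have h80 : (0 : ℝ) < 2 ^ 80 := by positivity
      have hlo' : (lo : ℝ) ≤ Real.log n * 2 ^ 80 := (div_le_iff₀ h80).1 hlo
      have hn1 : 1 ≤ n := by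
        rcases Nat.lt_or_ge n 1 with hcon | hcon
        · have hn0 : n = 0 := by omega
          rw [hn0, Nat.cast_zero, Real.log_zero, zero_mul] at hlo'
          linarith
        · exact hcon
      have hnpos : (0 : ℝ) < n := by exact_mod_cast hn1
      -- `log(t/2π) ≥ log n − 41 log 2 − log π ≥ ℓ/2^80 ≥ 0`
      have hlogle : Real.log ((n : ℝ) / 2 ^ 40 / (2 * π)) ≤ Real.log (t / (2 * π)) :=
        Real.log_le_log (by positivity) (div_le_div_of_nonneg_right ht₁ h2π.le)
      have hlogeq : Real.log ((n : ℝ) / 2 ^ 40 / (2 * π)) =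
          Real.log n - (41 * Real.log 2 + Real.log π) := by
        rw [div_div, Real.log_div hnpos.ne' (by positivity),
          show (2 : ℝ) ^ 40 * (2 * π) = 2 ^ 41 * π by ring,
          Real.log_mul (by positivity) hπ0.ne', Real.log_pow]
        push_cast
        ring
      set v : ℝ := (lo : ℝ) - C4180 with hv
      set y := Real.log (t / (2 * π)) with hydef
      have hy : v / 2 ^ 80 ≤ y := by
        have h1 : v ≤ (Real.log n - (41 * Real.log 2 + Real.log π)) * 2 ^ 80 := by
          rw [hv]; linarith
        have h2 : v / 2 ^ 80 ≤ Real.log n - (41 * Real.log 2 + Real.log π) := (div_le_iff₀ h80).2 h1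
        linarith
      have hv0 : 0 ≤ v := hℓR
      have hy0 : 0 ≤ v / 2 ^ 80 := by positivity
      have hy2 : (v / 2 ^ 80) ^ 2 ≤ y ^ 2 := pow_le_pow_left₀ hy0 hy 2
      -- the integer inequality, in `ℝ`: S · 2^102 · 3.1415926536 ≤ v²
      have hineqR : (invOrdSum (j + 1) : ℝ) * (2 ^ 102 * 31415926536) ≤ v * v * 10 ^ 10 := by
        rw [hv]; exact_mod_cast hineq
      generalize (invOrdSum (j + 1) : ℝ) = S at hineqR ⊢
      constructor
      · -- S/2^60 ≤ (v/2^80)²/(4·3.1415926536) ≤ y²/(4π)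
        have s1 : S / 2 ^ 60 ≤ (v / 2 ^ 80) ^ 2 / (4 * 3.1415926536) := by
          rw [div_pow, div_div, div_le_div_iff₀ (by positivity) (by positivity)]
          have e : ((2 : ℝ) ^ 80) ^ 2 * (4 * 3.1415926536) * 10 ^ 10 =
              (2 ^ 102 * 31415926536) * 2 ^ 60 := by norm_num
          have h10 : (0 : ℝ) < 10 ^ 10 := by positivity
          have : S * (((2 : ℝ) ^ 80) ^ 2 * (4 * 3.1415926536)) * 10 ^ 10 ≤ v ^ 2 * 2 ^ 60 * 10 ^ 10 := by
            calc S * (((2 : ℝ) ^ 80) ^ 2 * (4 * 3.1415926536)) * 10 ^ 10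
                = S * (2 ^ 102 * 31415926536) * 2 ^ 60 := by rw [mul_assoc S, e, ← mul_assoc]
              _ ≤ v * v * 10 ^ 10 * 2 ^ 60 := mul_le_mul_of_nonneg_right hineqR (by positivity)
              _ = v ^ 2 * 2 ^ 60 * 10 ^ 10 := by ring
          exact le_of_mul_le_mul_right this h10
        have s2 : (v / 2 ^ 80) ^ 2 / (4 * 3.1415926536) ≤ y ^ 2 / (4 * π) := by
          calc (v / 2 ^ 80) ^ 2 / (4 * 3.1415926536)
              ≤ (v / 2 ^ 80) ^ 2 / (4 * π) :=
                div_le_div_of_nonneg_left (sq_nonneg _) (by positivity) (by linarith)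
            _ ≤ y ^ 2 / (4 * π) := div_le_div_of_nonneg_right hy2 (by positivity)
        exact s1.trans s2
      · -- `log(t/2π) ≥ 0` gives `t ≥ 2π`
        have hy0' : 0 ≤ y := hy0.trans hy
        rw [hydef] at hy0'
        have := (Real.log_nonneg_iff (div_pos ht₁pos h2π)).1 hy0'
        rwa [le_div_iff₀ h2π, one_mul] at this
    · simp at hℓ
  · simp at h

/-- From the global check: for `5 ≤ j < 2000`,
`invOrdSum (j+1)/2⁶⁰ ≤ log²(t₁ⱼ/2π)/(4π)` and `2π ≤ t₁ⱼ`. [folklore] -/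
private theorem step_of_check {j : ℕ} (h5 : 5 ≤ j) (hj : j < 2000) :
    (invOrdSum (j + 1) : ℝ) / 2 ^ 60 ≤ Real.log (t₁ j / (2 * π)) ^ 2 / (4 * π) ∧ 2 * π ≤ t₁ j := by
  have h := harmonicLowCheck_eq.1
  unfold harmonicLowCheck at h
  rw [List.all_eq_true] at h
  have hj' := h j (List.mem_range.2 hj)
  rw [Bool.or_eq_true, decide_eq_true_eq] at hj'
  rcases hj' with hlt | hok
  · omega
  · exact stepOk_sound hj hok

/-! ## From the brackets to the zeros -/

/-- `Σ_{i<k} 1/γ_i ≤ invOrdSum k / 2⁶⁰` (`k ≤ 2000`). [cite: OdlyzkoTeRiele1985, §4.2 p. 151] -/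
theorem sum_inv_lowOrdinate_le {k : ℕ} (hk : k ≤ 2000) :
    ∑ i ∈ Finset.range k, 1 / lowOrdinate i ≤ (invOrdSum k : ℝ) / 2 ^ 60 := by
  have hterm : ∀ i ∈ Finset.range k, 1 / lowOrdinate i ≤ (invOrdTerm i : ℝ) / 2 ^ 60 := by
    intro i hi
    have hi' : i < 2000 := lt_of_lt_of_le (Finset.mem_range.1 hi) hk
    have ht := (lowOrdinate_spec hi').1.1
    rw [one_div]
    exact (inv_anti₀ (t₁_pos hi') ht).trans (inv_t₁_le hi')
  refine (Finset.sum_le_sum hterm).trans ?_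
  rw [← Finset.sum_div, invOrdSum_eq]
  push_cast
  exact le_rfl

/-- `invOrdSum` is monotone. [folklore] -/
private theorem invOrdSum_mono {a b : ℕ} (hab : a ≤ b) : invOrdSum a ≤ invOrdSum b := by
  rw [invOrdSum_eq, invOrdSum_eq]
  exact Finset.sum_le_sum_of_subset (Finset.range_mono hab)

/-- `log²(t/2π)/(4π)` is monotone in `t ≥ 2π`. [folklore] -/
private theorem rhs_mono {a b : ℝ} (ha : 2 * π ≤ a) (hab : a ≤ b) :
    Real.log (a / (2 * π)) ^ 2 / (4 * π) ≤ Real.log (b / (2 * π)) ^ 2 / (4 * π) := by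
  have h2π : (0 : ℝ) < 2 * π := by positivity
  have ha1 : 1 ≤ a / (2 * π) := by rwa [le_div_iff₀ h2π, one_mul]
  have hla : 0 ≤ Real.log (a / (2 * π)) := Real.log_nonneg ha1
  have hlab : Real.log (a / (2 * π)) ≤ Real.log (b / (2 * π)) :=
    Real.log_le_log (by positivity) (div_le_div_of_nonneg_right hab h2π.le)
  apply div_le_div_of_nonneg_right _ (by positivity)
  nlinarith

/-- `0.228 ≤ (1 + log 2)²/(4π) = log²(4πe/2π)/(4π)`. [folklore] -/
private theorem rhs_at_four_pi_e : (0.228 : ℝ) ≤ Real.log (4 * π * Real.exp 1 / (2 * π)) ^ 2 / (4 * π) := by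
  have hπ0 : 0 < π := Real.pi_pos
  have hπhi : π < 3.1415926536 := by linarith [Real.pi_lt_d20]
  have hl2 : 0.6931471803 < Real.log 2 := Real.log_two_gt_d9
  have e : 4 * π * Real.exp 1 / (2 * π) = 2 * Real.exp 1 := by field_simp; ring
  rw [e, Real.log_mul (by norm_num) (Real.exp_pos 1).ne', Real.log_exp]
  rw [le_div_iff₀ (by positivity)]
  nlinarith

end HarmonicLow

open HarmonicLow

/-! ## Lemma 8 on `[4πe, 2516]` (unconditional, computational lane) -/

set_option maxHeartbeats 400000 in -- the finset manipulations over the 2000 zeros are heavy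
/-- **Brent–Platt–Trudgian 2022, Lemma 8, on the printed initial range, proved in the kernel's
arithmetic from the tree's certified first `2000` zeros**: for `4πe ≤ T ≤ 2516`,
`Σ_{0<γ≤T} m(ρ)/γ ≤ log²(T/2π)/(4π)`. Proof: every zero with `0 < Im ρ ≤ 2516` is a simple zero
`½ + iγ_j` (`zero_eq_of_im_le_heightT0`); if `J = {j : γ_j ≤ T}` is empty the sum vanishes; else with
`m = max J`, the sum is `≤ Σ_{j≤m} 1/γ_j ≤ invOrdSum (m+1)/2⁶⁰`, which is `≤ log²(t/2π)/(4π)` at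
`t = 4πe` (`m ≤ 4`, `harmonicLowCheck_eq.2`, `rhs_at_four_pi_e`) resp. at `t = t₁,ₘ ≤ γ_m ≤ T`
(`m ≥ 5`, `step_of_check`), and the right side increases (`rhs_mono`).
[cite: BrentPlattTrudgian2022, Lemma 8] -/
theorem sum_inv_ordinate_le_of_le_heightT0 {T : ℝ} (hT : 4 * π * Real.exp 1 ≤ T)
    (hT' : T ≤ (heightT0 : ℝ)) :
    ∑ ρ ∈ zerosBetween 0 T, (riemannZetaZeroOrder ρ : ℝ) / ρ.im ≤ Real.log (T / (2 * π)) ^ 2 / (4 * π) := by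
  classical
  have hπ0 : 0 < π := Real.pi_pos
  have hπ3 : 3.14159 < π := by linarith [Real.pi_gt_d6]
  have he1 : 2.7182818283 < Real.exp 1 := Real.exp_one_gt_d9
  have h2π : (0 : ℝ) < 2 * π := by positivity
  have hT2π : 2 * π ≤ T := le_trans (by nlinarith [Real.exp_pos 1]) hT
  have hT0 : 0 < T := h2π.trans_le hT2π
  -- the zeros up to T as an image of the indices j with γ_j ≤ T
  set J : Finset ℕ := (Finset.range 2000).filter (fun j ↦ lowOrdinate j ≤ T) with hJ
  have hzeros : zerosBetween 0 T = J.image (fun j ↦ (1 / 2 + lowOrdinate j * I : ℂ)) := by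
    ext ρ
    rw [mem_zerosBetween le_rfl, Finset.mem_image]
    constructor
    · rintro ⟨hz, h0, h1, him, hle⟩
      obtain ⟨j, hj, rfl⟩ := zero_eq_of_im_le_heightT0 hz h0 h1 him (hle.trans hT')
      refine ⟨j, ?_, rfl⟩
      rw [hJ, Finset.mem_filter, Finset.mem_range]
      exact ⟨hj, by simpa using hle⟩
    · rintro ⟨j, hj, rfl⟩
      rw [hJ, Finset.mem_filter, Finset.mem_range] at hj
      obtain ⟨hj, hle⟩ := hj
      obtain ⟨hp, -⟩ := lowOrdinate_pos_lt hj
      exact ⟨(lowOrdinate_spec hj).2, by simp, by norm_num, by simpa using hp, by simpa using hle⟩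
  have hJsub : J ⊆ Finset.range 2000 := Finset.filter_subset _ _
  have hinj : Set.InjOn (fun j ↦ (1 / 2 + lowOrdinate j * I : ℂ)) (J : Set ℕ) := by
    intro j hj j' hj' h
    exact lowOrdinate_injOn (hJsub hj) (hJsub hj') (by have := congrArg Complex.im h; simpa using this)
  rw [hzeros, Finset.sum_image hinj]
  have hterm : ∀ j ∈ J, (riemannZetaZeroOrder (1 / 2 + lowOrdinate j * I) : ℝ) /
      (1 / 2 + lowOrdinate j * I : ℂ).im = 1 / lowOrdinate j := by
    intro j hj
    have hj' : j < 2000 := Finset.mem_range.1 (hJsub hj)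
    rw [riemannZetaZeroOrder_lowOrdinate hj']
    simp
  rw [Finset.sum_congr rfl hterm]
  -- the right side is ≥ 0
  have hR0 : 0 ≤ Real.log (T / (2 * π)) ^ 2 / (4 * π) := by positivity
  by_cases hJe : J = ∅
  · rw [hJe, Finset.sum_empty]; exact hR0
  -- m = max J
  obtain ⟨m, hm⟩ : ∃ m, m ∈ J ∧ ∀ j ∈ J, j ≤ m :=
    ⟨J.max' (Finset.nonempty_of_ne_empty hJe), Finset.max'_mem _ _, fun j hj ↦ Finset.le_max' _ _ hj⟩
  obtain ⟨hmJ, hmax⟩ := hm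
  have hm2000 : m < 2000 := Finset.mem_range.1 (hJsub hmJ)
  have hmT : lowOrdinate m ≤ T := by
    have := hmJ; rw [hJ, Finset.mem_filter] at this; exact this.2
  have hJm : J ⊆ Finset.range (m + 1) := fun j hj ↦ Finset.mem_range.2 (Nat.lt_succ_of_le (hmax j hj))
  have hnn : ∀ j ∈ Finset.range (m + 1), j ∉ J → (0 : ℝ) ≤ 1 / lowOrdinate j := by
    intro j hj _
    have hj' : j < 2000 := lt_of_lt_of_le (Finset.mem_range.1 hj) (by omega)
    exact (one_div_pos.2 (lowOrdinate_pos_lt hj').1).le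
  have hsum1 : ∑ j ∈ J, 1 / lowOrdinate j ≤ ∑ j ∈ Finset.range (m + 1), 1 / lowOrdinate j :=
    Finset.sum_le_sum_of_subset_of_nonneg hJm hnn
  have hsum2 := sum_inv_lowOrdinate_le (k := m + 1) (by omega)
  have ht₁m : t₁ m ≤ T := ((lowOrdinate_spec hm2000).1.1).trans hmT
  by_cases h5 : 5 ≤ m
  · -- the step test at j = m
    obtain ⟨hstep, h2πt⟩ := step_of_check h5 hm2000
    have hmono := rhs_mono h2πt ht₁m
    linarith
  · -- m ≤ 4: the first five zeros against 4πe
    have h5 : m < 5 := not_le.1 h5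
    have hmono1 : (invOrdSum (m + 1) : ℝ) ≤ invOrdSum 5 := by
      exact_mod_cast invOrdSum_mono (by omega : m + 1 ≤ 5)
    have hchk : (invOrdSum 5 : ℝ) * 1000 ≤ 228 * 2 ^ 60 := by exact_mod_cast harmonicLowCheck_eq.2
    have h5le : (invOrdSum (m + 1) : ℝ) / 2 ^ 60 ≤ 0.228 := by
      rw [div_le_iff₀ (by positivity)]
      linarith
    have hmono := rhs_mono (a := 4 * π * Real.exp 1) (b := T) (by nlinarith [Real.exp_pos 1]) hT
    have h4 := rhs_at_four_pi_e
    linarith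

/-! ## Lemma 8 for all `T ≥ 4πe` from Corollary 1 -/

/-- **Brent–Platt–Trudgian 2022, Lemma 8, from Corollary 1**: for every `T ≥ 4πe`,
`Σ_{0<γ≤T} m(ρ)/γ ≤ log²(T/2π)/(4π)` — below `2516` by `sum_inv_ordinate_le_of_le_heightT0`
(unconditional), above by Lehman's lemma with `A = 0.28` (`sum_inv_le_of_ge_2516`, gen 2).
[cite: BrentPlattTrudgian2022, Lemma 8 and Cor. 1] -/
theorem BrentPlattTrudgian2022_cor1.sum_inv_le (h : BrentPlattTrudgian2022_cor1) {T : ℝ}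
    (hT : 4 * π * Real.exp 1 ≤ T) :
    ∑ ρ ∈ zerosBetween 0 T, (riemannZetaZeroOrder ρ : ℝ) / ρ.im ≤ Real.log (T / (2 * π)) ^ 2 / (4 * π) := by
  have hH : ((heightT0 : ℕ) : ℝ) = 2516 := by norm_num [heightT0]
  rcases le_or_gt T (heightT0 : ℝ) with hle | hgt
  · exact sum_inv_ordinate_le_of_le_heightT0 hT hle
  · rw [hH] at hgt
    exact h.sum_inv_le_of_ge_2516 hgt.le

/-- **`BrentPlattTrudgian2022_cor1 → BrentPlattTrudgian2022_lemma8`**: the named fact Lemma 8 is a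
consequence of the named fact Corollary 1 (and the tree's certified zeros).
[cite: BrentPlattTrudgian2022, Lemma 8 and Cor. 1] -/
theorem BrentPlattTrudgian2022_lemma8_of_cor1 (h : BrentPlattTrudgian2022_cor1) :
    BrentPlattTrudgian2022_lemma8 := fun _ hT ↦ h.sum_inv_le hT

end Literature.NumberTheory.LFunctions

end
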